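import Summits.MatrixMultiplication.MatrixMultiplication.Theorems.ObstructionDescentLevelTwoSymmetry
import Summits.MatrixMultiplication.MatrixMultiplication.Theorems.ObstructionDescentFormatTwoLevels

set_option linter.dupNamespace false

/-!
# Obstruction descent, part AF — LEVEL 2 AT FORMAT 2 IS CAYLEY'S LINE: part AE made UNCONDITIONAL

`route-MatrixMultiplication-ObstructionDescent`, aside `InvariantSaturation` (stmt 32282); decomp-mm lens-3, NODE-g16.

Part AE proved: IF the slot permutations act trivially on `R₂(2) = hwvSpace (rectType 2 2 2) 4`, then every level-2
highest weight vector of every format `N ≥ 2` is `S₃`-symmetric on tensors of rank `≤ N + 2`.  This file discharges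
the hypothesis inside the tree, with part N's five-cell family `T(p,x,y,z) = e₁₁₁ + p e₀₀₀ + x e₁₀₀ + y e₀₁₀ + z e₀₀₁`:

* §1 `evalT_family_level_two`: for `f ∈ R₂(2)`, `f(T(p,x,y,z)) = c₀ p² + c₁ xyz` (`c₀, c₁` the coefficients of `x₀₀₀²x₁₁₁²`
  and `x₀₀₁x₀₁₀x₁₀₀x₁₁₁`) — part N's `evalT_family` at `k = 2`; `eq_zero_of_family_eval_eq_zero`: a vector of `R_k(2)`
  vanishing on the family is `0` (part N's Borel normalisation + the line through `e₁₁₁`, isolated as a lemma);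
* §2 the family is stable under the slot transpositions up to permuting `x, y, z`, and `c₀ p² + c₁ xyz` is symmetric, so
  `f^σ − f ∈ R₂(2)` vanishes on the family: **`rename_slotPerm_eq_self_level_two_two`** — EVERY `σ ∈ S₃` FIXES EVERY
  `f ∈ R₂(2)` (`perm_fin_three_cases` + part AB's `slotChar_mul`);
* §3 **`evalT_permT_level_two_symm`** (UNCONDITIONAL): for every `N ≥ 2`, every `f ∈ R₂(N) = hwvSpace (rectType N N 2) (2N)`,
  every `σ ∈ S₃` and every tensor `t` of rank `≤ N + 2`: `f(σ·t) = f(t)`; corner form at every ambient format; in words: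
  the level-2 part of the unit-tensor tower cannot distinguish a tensor of border-rank-relevant size from its transposes;
* §4 the even sign law `evalT_actTensor_permMatrix_of_even`, the EVEN functional equation of the family coefficients
  `family_functional_equation_even` (`Σ_β c_β (1+2s)^{k−2β}(−s²)^β = +Σ_β c_β s^β`), at `k = 2`: `c₁ = 4c₀`
  (`levelTwo_coeff_rel` — Cayley's `Δ = x₀₀₀²x₁₁₁² + … + 4(x₀₀₀x₀₁₁x₁₀₁x₁₁₀ + x₀₀₁x₀₁₀x₁₀₀x₁₁₁)` indeed has `c₀ = 1, c₁ = 4`),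
  hence `R₂(2)` IS A LINE: `smul_eq_smul_level_two_two` (`c₀(g)·f = c₀(f)·g`), `exists_line_level_two_two`
  (`R₂(2) = ℂ·Δ`, i.e. `g((2,2),(2,2),(2,2)) = 1` in the route's language).

[cite: GelfandKapranovZelevinsky1994, Ch. 14 §1], [cite: BremnerHuOeding2014, §1], [cite: BurgisserIkenmeyer2011, §3.1–3.2],
[cite: BurgisserIkenmeyer2017, §5].
-/

noncomputable section

open scoped BigOperators
open Finset

namespace Summit.MatrixMultiplication.MatrixMultiplication.Theorems.ObstructionCalculus

open Literature.Computability.AlgebraicComplexity (actTensor actTensor_apply actTensor_actTensor actTensor_permMatrix_apply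
  tensorRank)

section LevelTwoLine

variable {m k : ℕ}

/-! ### §1 The family at level 2, and the family determines the vector -/

/-- **A vector of `R_k(2)` vanishing on the five-cell family is zero** (part N's normalisation, isolated). [this node] -/
theorem eq_zero_of_family_eval_eq_zero {f : MvPolynomial (Idx 2) ℂ} (hf : f ∈ hwvSpace (rectType 2 2 k) (k * 2))
    (hfam : ∀ p x y z : ℂ, evalT (fun a b c => ![![![p, z], ![y, 0]], ![![x, 0], ![0, 1]]] a b c) f = 0) : f = 0 := by
  classical
  -- every tensor with `t₁₁₁ ≠ 0` is carried into the family by a Borel triple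
  have hmain : ∀ t : Tensor ℂ 2, t 1 1 1 ≠ 0 → evalT t f = 0 := by
    intro t ht
    set A : Matrix (Fin 2) (Fin 2) ℂ := !![1, -(t 0 1 1) / t 1 1 1; 0, (t 1 1 1)⁻¹] with hAd
    set B : Matrix (Fin 2) (Fin 2) ℂ := !![1, -(t 1 0 1) / t 1 1 1; 0, 1] with hBd
    set C : Matrix (Fin 2) (Fin 2) ℂ := !![1, -(t 1 1 0) / t 1 1 1; 0, 1] with hCd
    have hAb : A ∈ borel 2 := by
      refine ⟨fun i j hji => ?_, fun i => ?_⟩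
      · fin_cases i <;> fin_cases j <;> simp [hAd] at hji ⊢
      · fin_cases i <;> simp [hAd, ht]
    have hBb : B ∈ borel 2 := by
      refine ⟨fun i j hji => ?_, fun i => ?_⟩
      · fin_cases i <;> fin_cases j <;> simp [hBd] at hji ⊢
      · fin_cases i <;> simp [hBd]
    have hCb : C ∈ borel 2 := by
      refine ⟨fun i j hji => ?_, fun i => ?_⟩
      · fin_cases i <;> fin_cases j <;> simp [hCd] at hji ⊢
      · fin_cases i <;> simp [hCd]
    have key := hf.2 A B C hAb hBb hCb t
    have hform : actTensor A B C t = fun a b c =>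
        ![![![actTensor A B C t 0 0 0, actTensor A B C t 0 0 1], ![actTensor A B C t 0 1 0, 0]],
          ![![actTensor A B C t 1 0 0, 0], ![0, 1]]] a b c := by
      funext a b c
      fin_cases a <;> fin_cases b <;> fin_cases c
      · simp
      · simp
      · simp
      · simp [actTensor_apply, Fin.sum_univ_two, hAd, hBd, hCd]
        field_simp
        ring
      · simp
      · simp [actTensor_apply, Fin.sum_univ_two, hAd, hBd, hCd]
        field_simp
        ring
      · simp [actTensor_apply, Fin.sum_univ_two, hAd, hBd, hCd]
        field_simp
        ring
      · simp [actTensor_apply, Fin.sum_univ_two, hAd, hBd, hCd, ht]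
    rw [hform, hfam] at key
    exact (mul_eq_zero.mp key.symm).resolve_left
      (mul_ne_zero (mul_ne_zero (weightChar_ne_zero _ hAb) (weightChar_ne_zero _ hBb)) (weightChar_ne_zero _ hCb))
  -- every tensor, by the line through `e₁₁₁`
  have hall : ∀ t : Tensor ℂ 2, evalT t f = 0 := by
    intro t
    obtain ⟨Q, hQ⟩ := exists_polynomial_evalT_line f t (fun a b c => if a = 1 ∧ b = 1 ∧ c = 1 then (1 : ℂ) else 0)
    have hroot : ({-t 1 1 1}ᶜ : Set ℂ) ⊆ {u | Q.IsRoot u} := by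
      intro u hu
      rw [Set.mem_compl_singleton_iff] at hu
      rw [Set.mem_setOf_eq, Polynomial.IsRoot.def, ← hQ]
      apply hmain
      simp only [Pi.add_apply, Pi.smul_apply, smul_eq_mul, and_self, if_true, mul_one]
      intro h
      exact hu (by linear_combination h)
    have hQ0 : Q = 0 :=
      Polynomial.eq_zero_of_infinite_isRoot Q (((Set.finite_singleton (-t 1 1 1)).infinite_compl).mono hroot)
    have h0 := hQ 0
    rwa [zero_smul, add_zero, hQ0, Polynomial.eval_zero] at h0
  apply MvPolynomial.funext
  intro v
  have h := hall fun a b c => v (a, b, c)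
  rw [evalT, MvPolynomial.aeval_eq_eval] at h
  rw [map_zero]
  simpa only [Prod.mk.eta] using h

/-- **The family at level 2:** `f(T(p,x,y,z)) = c₀ p² + c₁ xyz` for `f ∈ R₂(2)`. [this node] -/
theorem evalT_family_level_two {f : MvPolynomial (Idx 2) ℂ} (hf : f ∈ hwvSpace (rectType 2 2 2) (2 * 2)) (p x y z : ℂ) :
    evalT (fun a b c => ![![![p, z], ![y, 0]], ![![x, 0], ![0, 1]]] a b c) f =
      f.coeff (Finsupp.equivFunOnFinite.symm fun q : Idx 2 =>
          ![![![2, 0], ![0, 0]], ![![0, 0], ![0, 2]]] q.1 q.2.1 q.2.2) * p ^ 2 +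
        f.coeff (Finsupp.equivFunOnFinite.symm fun q : Idx 2 =>
          ![![![0, 1], ![1, 0]], ![![1, 0], ![0, 1]]] q.1 q.2.1 q.2.2) * (x * y * z) := by
  have h := evalT_family (k := 2) hf p x y z
  rw [show (2 / 2 + 1 : ℕ) = 0 + 1 + 1 from rfl] at h
  simp only [Finset.sum_range_succ, Finset.sum_range_zero, zero_add, Nat.reduceMul, Nat.reduceSub] at h
  linear_combination h

/-! ### §2 Every slot permutation fixes every vector of `R₂(2)` -/

/-- The transposition of legs `1 ↔ 2` in coordinates: `t ↦ t(a,c,b)`. [bookkeeping] -/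
theorem permT_swap_one_two (t : Tensor ℂ m) : permT (Equiv.swap 1 2) t = fun a b c => t a c b := by
  have h0 : (Equiv.swap (1 : Fin 3) 2) 0 = 0 := by decide
  have h1 : (Equiv.swap (1 : Fin 3) 2) 1 = 2 := by decide
  have h2 : (Equiv.swap (1 : Fin 3) 2) 2 = 1 := by decide
  funext a b c
  rw [permT_apply, h0, h1, h2]
  rfl

/-- `(0 1)` on the family swaps `x` and `y`. [bookkeeping] -/
theorem permT_swap_zero_one_family (p x y z : ℂ) :
    permT (Equiv.swap 0 1) (fun a b c => ![![![p, z], ![y, 0]], ![![x, 0], ![0, 1]]] a b c : Tensor ℂ 2) =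
      fun a b c => ![![![p, z], ![x, 0]], ![![y, 0], ![0, 1]]] a b c := by
  rw [permT_swap_zero_one]
  funext a b c
  fin_cases a <;> fin_cases b <;> fin_cases c <;> rfl

/-- `(1 2)` on the family swaps `y` and `z`. [bookkeeping] -/
theorem permT_swap_one_two_family (p x y z : ℂ) :
    permT (Equiv.swap 1 2) (fun a b c => ![![![p, z], ![y, 0]], ![![x, 0], ![0, 1]]] a b c : Tensor ℂ 2) =
      fun a b c => ![![![p, y], ![z, 0]], ![![x, 0], ![0, 1]]] a b c := by
  rw [permT_swap_one_two]
  funext a b c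
  fin_cases a <;> fin_cases b <;> fin_cases c <;> rfl

/-- A slot permutation that maps the family into itself up to a permutation of `x, y, z` fixes every `f ∈ R₂(2)`.
[this node] -/
theorem rename_slotPerm_eq_self_of_family (σ : Equiv.Perm (Fin 3))
    (hσ : ∀ p x y z : ℂ, ∃ x' y' z' : ℂ, x' * y' * z' = x * y * z ∧
      permT σ (fun a b c => ![![![p, z], ![y, 0]], ![![x, 0], ![0, 1]]] a b c : Tensor ℂ 2) =
        fun a b c => ![![![p, z'], ![y', 0]], ![![x', 0], ![0, 1]]] a b c)
    {g : MvPolynomial (Idx 2) ℂ} (hg : g ∈ hwvSpace (rectType 2 2 2) (2 * 2)) :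
    MvPolynomial.rename (slotPerm σ) g = g := by
  rw [← sub_eq_zero]
  refine eq_zero_of_family_eval_eq_zero (k := 2) (Submodule.sub_mem _ (rename_slotPerm_mem_level hg σ) hg) ?_
  intro p x y z
  obtain ⟨x', y', z', hprod, hperm⟩ := hσ p x y z
  rw [map_sub, evalT_rename_slotPerm, hperm, evalT_family_level_two hg, evalT_family_level_two hg, hprod, sub_self]

/-- `(0 1)` and `(1 2)` fix every `f ∈ R₂(2)`. [this node] -/
theorem rename_swap_eq_self_level_two_two {g : MvPolynomial (Idx 2) ℂ} (hg : g ∈ hwvSpace (rectType 2 2 2) (2 * 2)) :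
    MvPolynomial.rename (slotPerm (Equiv.swap 0 1)) g = g ∧ MvPolynomial.rename (slotPerm (Equiv.swap 1 2)) g = g :=
  ⟨rename_slotPerm_eq_self_of_family _ (fun p x y z => ⟨y, x, z, by ring, permT_swap_zero_one_family p x y z⟩) hg,
    rename_slotPerm_eq_self_of_family _ (fun p x y z => ⟨x, z, y, by ring, permT_swap_one_two_family p x y z⟩) hg⟩

/-- The six elements of `S₃` as words in `(0 1)`, `(1 2)`. [bookkeeping] -/
theorem perm_fin_three_cases : ∀ σ : Equiv.Perm (Fin 3), σ = 1 ∨ σ = Equiv.swap 0 1 ∨ σ = Equiv.swap 1 2 ∨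
    σ = Equiv.swap 0 1 * Equiv.swap 1 2 ∨ σ = Equiv.swap 1 2 * Equiv.swap 0 1 ∨
    σ = Equiv.swap 0 1 * Equiv.swap 1 2 * Equiv.swap 0 1 := by
  decide

/-- **Every slot permutation fixes every vector of `R₂(2)`** (`R₂(2) = ℂ·Δ` and Cayley's `Δ` is symmetric — proved here
without computing `Δ`). [this node] -/
theorem rename_slotPerm_eq_self_level_two_two (σ : Equiv.Perm (Fin 3)) {g : MvPolynomial (Idx 2) ℂ}
    (hg : g ∈ hwvSpace (rectType 2 2 2) (2 * 2)) : MvPolynomial.rename (slotPerm σ) g = g := by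
  obtain ⟨h01, h12⟩ := rename_swap_eq_self_level_two_two hg
  have gen : ∀ σ τ : Equiv.Perm (Fin 3), MvPolynomial.rename (slotPerm σ) g = g →
      MvPolynomial.rename (slotPerm τ) g = g → MvPolynomial.rename (slotPerm (τ * σ)) g = g := by
    intro σ τ hσ hτ
    have h := slotChar_mul (a := 1) (b := 1) (by rw [one_smul]; exact hσ) (by rw [one_smul]; exact hτ)
    rwa [one_mul, one_smul] at h
  rcases perm_fin_three_cases σ with rfl | rfl | rfl | rfl | rfl | rfl
  · exact rename_slotPerm_one g
  · exact h01
  · exact h12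
  · exact gen _ _ h12 h01
  · exact gen _ _ h01 h12
  · exact gen _ _ h01 (gen _ _ h12 h01)

/-! ### §3 UNCONDITIONAL: every level-2 vector of every format is `S₃`-symmetric on `σ_{N+2}` -/

/-- **`S₃`-SYMMETRY OF LEVEL 2 (unconditional).**  For every format `N ≥ 2`, every `f ∈ R₂(N)`, every `σ ∈ S₃` and every
tensor `t` of rank `≤ N + 2`: `f(σ·t) = f(t)`. [this node] -/
theorem evalT_permT_level_two_symm (σ : Equiv.Perm (Fin 3)) {N : ℕ} (hN : 2 ≤ N) {f : MvPolynomial (Idx N) ℂ}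
    (hf : f ∈ hwvSpace (rectType N N 2) (2 * N)) {t : Tensor ℂ N} (ht : tensorRank t ≤ N + 2) :
    evalT (permT σ t) f = evalT t f :=
  evalT_permT_level_two_eq σ (fun _ hg => rename_slotPerm_eq_self_level_two_two σ hg) hN hf ht

/-- The same for corner vectors at every ambient format `m ≥ N ≥ 2`. [this node] -/
theorem evalT_permT_level_two_symm_corner (σ : Equiv.Perm (Fin 3)) {N m : ℕ} (hN : 2 ≤ N) (hNm : N ≤ m)
    {F : MvPolynomial (Idx m) ℂ} (hF : F ∈ hwvSpace (rectType m N 2) (2 * N)) {s : Tensor ℂ m}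
    (hs : tensorRank s ≤ N + 2) : evalT (permT σ s) F = evalT s F := by
  have h := evalT_permT_level_two_corner σ (χ := 1)
    (fun g hg => by rw [one_smul]; exact rename_slotPerm_eq_self_level_two_two σ hg) hN hNm hF hs
  rwa [one_mul] at h

/-- Polynomial form: `f^σ − f` vanishes on `σ_{N+2}` for every `f ∈ R₂(N)`, `N ≥ 2`. [this node] -/
theorem evalT_rename_sub_self_eq_zero_level_two (σ : Equiv.Perm (Fin 3)) {N : ℕ} (hN : 2 ≤ N)
    {f : MvPolynomial (Idx N) ℂ} (hf : f ∈ hwvSpace (rectType N N 2) (2 * N)) {t : Tensor ℂ N}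
    (ht : tensorRank t ≤ N + 2) : evalT t (MvPolynomial.rename (slotPerm σ) f - f) = 0 := by
  rw [map_sub, evalT_rename_slotPerm, evalT_permT_level_two_symm σ hN hf ht, sub_self]

/-! ### §4 The even functional equation; `R₂(2)` is a line -/

/-- **Even sign law for corner permutations:** for `k` even, a simultaneous corner permutation acts trivially on every
weight vector of type `rectType m N k`. [this node] -/
theorem evalT_actTensor_permMatrix_of_even {N d : ℕ} (hk : Even k) {f : MvPolynomial (Idx m) ℂ}
    (hf : f ∈ hwvSpace (rectType m N k) d) (σ : Equiv.Perm (Fin m)) (hσ : ∀ a, σ a ≠ a → m ≤ (a : ℕ) + N)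
    (x : Tensor ℂ m) :
    evalT (actTensor (σ.permMatrix ℂ) (σ.permMatrix ℂ) (σ.permMatrix ℂ) x) f = evalT x f := by
  have hσ' : ∀ s : Fin 3, ∀ a, σ a ≠ a → rectType m N k s a = k := fun s a ha => by
    simp only [rectType, if_pos (hσ a ha)]
  have h3 : actTensor (σ.permMatrix ℂ) (σ.permMatrix ℂ) (σ.permMatrix ℂ) x =
      slotAct 0 (σ.permMatrix ℂ) (slotAct 1 (σ.permMatrix ℂ) (slotAct 2 (σ.permMatrix ℂ) x)) := by
    simp only [slotAct_zero, slotAct_one, slotAct_two, actTensor_actTensor, Matrix.mul_one, Matrix.one_mul]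
  have hs : (((Equiv.Perm.sign σ : ℤˣ) : ℤ) : ℂ) ^ k = 1 := by
    rcases Int.units_eq_one_or (Equiv.Perm.sign σ) with h | h <;> simp [h, hk.neg_one_pow]
  rw [h3, evalT_slotAct_permMatrix hf 0 σ (hσ' 0), evalT_slotAct_permMatrix hf 1 σ (hσ' 1),
    evalT_slotAct_permMatrix hf 2 σ (hσ' 2), hs]
  ring

/-- **The EVEN functional equation of the family coefficients:** for `k` even, identically in `s`,
`Σ_β c_β (1+2s)^{k-2β}(-s²)^β = Σ_β c_β s^β` (part N's computation with the even sign law). [this node] -/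
theorem family_functional_equation_even (hk : Even k) {f : MvPolynomial (Idx 2) ℂ}
    (hf : f ∈ hwvSpace (rectType 2 2 k) (k * 2)) (s : ℂ) :
    ∑ β ∈ Finset.range (k / 2 + 1), f.coeff (Finsupp.equivFunOnFinite.symm fun q : Idx 2 =>
        ![![![k - 2 * β, β], ![β, 0]], ![![β, 0], ![0, k - β]]] q.1 q.2.1 q.2.2) *
          ((1 + 2 * s) ^ (k - 2 * β) * ((-1) * (-s) * (-s)) ^ β) =
      ∑ β ∈ Finset.range (k / 2 + 1), f.coeff (Finsupp.equivFunOnFinite.symm fun q : Idx 2 =>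
        ![![![k - 2 * β, β], ![β, 0]], ![![β, 0], ![0, k - β]]] q.1 q.2.1 q.2.2) * (1 ^ (k - 2 * β) * (s * 1 * 1) ^ β) := by
  classical
  set σ : Equiv.Perm (Fin 2) := Equiv.swap 0 1 with hσ
  have hσm : ∀ a : Fin 2, σ a ≠ a → 2 ≤ (a : ℕ) + 2 := fun a _ => by omega
  set A : Matrix (Fin 2) (Fin 2) ℂ := !![1, -s; 0, 1] with hA
  set S : Matrix (Fin 2) (Fin 2) ℂ := !![1, -1; 0, 1] with hS
  have hAb : A ∈ borel 2 := by
    refine ⟨fun i j hji => ?_, fun i => ?_⟩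
    · fin_cases i <;> fin_cases j <;> simp [hA] at hji ⊢
    · fin_cases i <;> simp [hA]
  have hSb : S ∈ borel 2 := by
    refine ⟨fun i j hji => ?_, fun i => ?_⟩
    · fin_cases i <;> fin_cases j <;> simp [hS] at hji ⊢
    · fin_cases i <;> simp [hS]
  have hwA : weightChar (rectType 2 2 k 0) A = 1 := by simp [weightChar, Fin.prod_univ_two, hA]
  have hwS : ∀ i : Fin 3, weightChar (rectType 2 2 k i) S = 1 := fun i => by
    simp [weightChar, Fin.prod_univ_two, hS]
  have hU := evalT_family hf 1 s 1 1
  have hV := evalT_actTensor_permMatrix_of_even hk hf σ hσm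
    (fun a b c => ![![![(1 : ℂ), 1], ![1, 0]], ![![s, 0], ![0, 1]]] a b c)
  have hVe : actTensor (σ.permMatrix ℂ) (σ.permMatrix ℂ) (σ.permMatrix ℂ)
      (fun a b c => ![![![(1 : ℂ), 1], ![1, 0]], ![![s, 0], ![0, 1]]] a b c) =
      fun a b c => ![![![(1 : ℂ), 0], ![0, s]], ![![0, 1], ![1, 1]]] a b c := by
    funext a b c
    rw [actTensor_permMatrix_apply]
    fin_cases a <;> fin_cases b <;> fin_cases c <;> simp [hσ]
  have hW := hf.2 A S S hAb hSb hSb (fun a b c => ![![![(1 : ℂ), 0], ![0, s]], ![![0, 1], ![1, 1]]] a b c)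
  have hWe : actTensor A S S (fun a b c => ![![![(1 : ℂ), 0], ![0, s]], ![![0, 1], ![1, 1]]] a b c) =
      fun a b c => ![![![1 + 2 * s, -s], ![-s, 0]], ![![-1, 0], ![0, 1]]] a b c := by
    funext a b c
    simp only [actTensor_apply, Fin.sum_univ_two, hA, hS]
    fin_cases a <;> fin_cases b <;> fin_cases c <;> simp
    all_goals ring
  have hT := evalT_family hf (1 + 2 * s) (-1) (-s) (-s)
  rw [hVe] at hV
  rw [hWe, hwA, hwS 1, hwS 2, one_mul, one_mul, one_mul, hT, hV, hU] at hW
  exact hW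

/-- **At level 2: `c₁ = 4 c₀`** (the even functional equation at `s = 1`: `9c₀ − c₁ = c₀ + c₁`). [this node] -/
theorem levelTwo_coeff_rel {f : MvPolynomial (Idx 2) ℂ} (hf : f ∈ hwvSpace (rectType 2 2 2) (2 * 2)) :
    f.coeff (Finsupp.equivFunOnFinite.symm fun q : Idx 2 =>
        ![![![0, 1], ![1, 0]], ![![1, 0], ![0, 1]]] q.1 q.2.1 q.2.2) =
      4 * f.coeff (Finsupp.equivFunOnFinite.symm fun q : Idx 2 =>
        ![![![2, 0], ![0, 0]], ![![0, 0], ![0, 2]]] q.1 q.2.1 q.2.2) := by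
  have h := family_functional_equation_even (k := 2) even_two hf 1
  rw [show (2 / 2 + 1 : ℕ) = 0 + 1 + 1 from rfl] at h
  simp only [Finset.sum_range_succ, Finset.sum_range_zero, zero_add, Nat.reduceMul, Nat.reduceSub] at h
  linear_combination (-1 / 2 : ℂ) * h

/-- **The family at level 2, closed form:** `f(T(p,x,y,z)) = c₀ (p² + 4xyz)`. [this node] -/
theorem evalT_family_level_two' {f : MvPolynomial (Idx 2) ℂ} (hf : f ∈ hwvSpace (rectType 2 2 2) (2 * 2)) (p x y z : ℂ) :
    evalT (fun a b c => ![![![p, z], ![y, 0]], ![![x, 0], ![0, 1]]] a b c) f =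
      f.coeff (Finsupp.equivFunOnFinite.symm fun q : Idx 2 =>
        ![![![2, 0], ![0, 0]], ![![0, 0], ![0, 2]]] q.1 q.2.1 q.2.2) * (p ^ 2 + 4 * (x * y * z)) := by
  rw [evalT_family_level_two hf, levelTwo_coeff_rel hf]
  ring

/-- **`c₀` detects the vector:** `f ∈ R₂(2)` with `c₀(f) = 0` is `0`. [this node] -/
theorem eq_zero_of_coeff_zero_level_two_two {f : MvPolynomial (Idx 2) ℂ} (hf : f ∈ hwvSpace (rectType 2 2 2) (2 * 2))
    (h0 : f.coeff (Finsupp.equivFunOnFinite.symm fun q : Idx 2 =>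
      ![![![2, 0], ![0, 0]], ![![0, 0], ![0, 2]]] q.1 q.2.1 q.2.2) = 0) : f = 0 :=
  eq_zero_of_family_eval_eq_zero hf fun p x y z => by rw [evalT_family_level_two' hf, h0, zero_mul]

/-- **`R₂(2)` is a line:** `c₀(g)·f = c₀(f)·g` for all `f, g ∈ R₂(2)`. [this node] -/
theorem smul_eq_smul_level_two_two {f g : MvPolynomial (Idx 2) ℂ} (hf : f ∈ hwvSpace (rectType 2 2 2) (2 * 2))
    (hg : g ∈ hwvSpace (rectType 2 2 2) (2 * 2)) :
    g.coeff (Finsupp.equivFunOnFinite.symm fun q : Idx 2 =>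
        ![![![2, 0], ![0, 0]], ![![0, 0], ![0, 2]]] q.1 q.2.1 q.2.2) • f =
      f.coeff (Finsupp.equivFunOnFinite.symm fun q : Idx 2 =>
        ![![![2, 0], ![0, 0]], ![![0, 0], ![0, 2]]] q.1 q.2.1 q.2.2) • g := by
  rw [← sub_eq_zero]
  refine eq_zero_of_coeff_zero_level_two_two (Submodule.sub_mem _ (Submodule.smul_mem _ _ hf)
    (Submodule.smul_mem _ _ hg)) ?_
  rw [MvPolynomial.coeff_sub, MvPolynomial.coeff_smul, MvPolynomial.coeff_smul, smul_eq_mul, smul_eq_mul, mul_comm,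
    sub_self]

/-- **`R₂(2) = ℂ·Δ`:** there is a non-zero `Δ ∈ R₂(2)` (part O) and every vector of `R₂(2)` is a multiple of it —
`g((2,2),(2,2),(2,2)) = 1` in the route's language. [this node] -/
theorem exists_line_level_two_two : ∃ Δ : MvPolynomial (Idx 2) ℂ, Δ ≠ 0 ∧ Δ ∈ hwvSpace (rectType 2 2 2) (2 * 2) ∧
    ∀ g ∈ hwvSpace (rectType 2 2 2) (2 * 2), ∃ c : ℂ, g = c • Δ := by
  obtain ⟨Δ, hΔ0, hΔ⟩ := exists_level_two_vector_two
  refine ⟨Δ, hΔ0, hΔ, fun g hg => ?_⟩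
  set d : ℂ := Δ.coeff (Finsupp.equivFunOnFinite.symm fun q : Idx 2 =>
    ![![![2, 0], ![0, 0]], ![![0, 0], ![0, 2]]] q.1 q.2.1 q.2.2) with hd
  have hd0 : d ≠ 0 := fun h => hΔ0 (eq_zero_of_coeff_zero_level_two_two hΔ h)
  refine ⟨d⁻¹ * g.coeff (Finsupp.equivFunOnFinite.symm fun q : Idx 2 =>
    ![![![2, 0], ![0, 0]], ![![0, 0], ![0, 2]]] q.1 q.2.1 q.2.2), ?_⟩
  rw [mul_smul, smul_eq_smul_level_two_two hΔ hg, ← hd, smul_smul, inv_mul_cancel₀ hd0, one_smul]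

end LevelTwoLine

end Summit.MatrixMultiplication.MatrixMultiplication.Theorems.ObstructionCalculus
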